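/- Width seat `ym-line-cbag-p1-w3` (prover-ym-line-cbag-p1-w3-g0-0), route `ColdBoxAllGroups`, crux `BoxFloorAllGroups`
(stmt-QuantumFields-22254), line `birth`, lead's PLAN v5: brick B4 «RepresentationG», ball-local density form. -/
import Summits.QuantumFields.YangMills.Theorems.ColdBoxAllGroupsBoxFloorAllGroupsRepresentationG

/-!
# Crux `BoxFloorAllGroups`, brick B4 «RepresentationG»: the representation with a chart density that is positive on the ball only

The exact Helgason Jacobian `J` of `…ChartDensityJ` (w2, p581209) is controlled on the chart ball only (`1/2 ≤ J ≤ 3/2` for `‖a‖ ≤ r₂`).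
The representation `integral_cond_boxState_eq_integral_tilted_G` (`…RepresentationG`, p581686) only ever evaluates the density at chart
coordinates inside the window `‖a‖ ≤ r`, so positivity of `g` ON THE BALL suffices: replace `g` off the ball by `1` (`hdens` only sees `g` on
the ball — `withDensity_congr_ae` under `c • vol|_B`; the tilt `𝟙_S·tiltWE` only sees `g` at coordinates of norm `≤ r` —
`indicator_tiltWE_ballClamp`).  Result: **`integral_cond_boxState_eq_integral_tilted_G'`**, hypotheses verbatim those of the unprimed theorem
except `hgpos : ∀ a, ‖a‖ ≤ r → 0 < g a`; consumed with `c = ENNReal.ofReal cH`, `g = J` from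
`exists_chartMeasureE_restrict_closedBall_eq_withDensity`.  No sorry; no definition; standard axioms.  NOT a claim about the mass gap.
-/

set_option autoImplicit false

noncomputable section

open MeasureTheory ProbabilityTheory Finset Metric
open scoped ENNReal Matrix.Norms.Frobenius
open Literature.MathematicalPhysics.QuantumLattice
open Literature.MathematicalPhysics.QuantumFieldTheory
open Literature.MathematicalPhysics.QuantumFieldTheory.AxialGauge

namespace Summit.QuantumFields.YangMills.Theorems.ColdBoxAllGroups

open Summit.QuantumFields.YangMills.Theorems.WeakCouplingRates
open Summit.QuantumFields.YangMills.Theorems.FreeEnergyLogCoefficient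

variable {H : ℕ} {N : ℕ} {G : Type} [Group G] (ρ : G →* Matrix (Fin N) (Fin N) ℂ)

/-- Off-ball modification of a density (`g` on `‖a‖ ≤ r`, `1` elsewhere) is measurable. -/
theorem measurable_ballClamp {D : ℕ} {g : EuclideanSpace ℝ (Fin D) → ℝ} (hgm : Measurable g) (r : ℝ) :
    Measurable fun a : EuclideanSpace ℝ (Fin D) => if ‖a‖ ≤ r then g a else 1 :=
  Measurable.ite (measurableSet_le measurable_norm measurable_const) hgm measurable_const

/-- On the window `S = goodTE ∩ {∀ e, ‖a_e‖ ≤ r}`, the tilt does not see the density off the ball. -/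
theorem indicator_tiltWE_ballClamp (g : EuclideanSpace ℝ (Fin (dimE ρ)) → ℝ) (β ε r : ℝ) :
    (goodTE ρ H β ε ∩ {t | ∀ e, ‖unscaleTE H (dimE ρ) β t e‖ ≤ r}).indicator
        (tiltWE ρ H (fun a => if ‖a‖ ≤ r then g a else 1) β) =
      (goodTE ρ H β ε ∩ {t | ∀ e, ‖unscaleTE H (dimE ρ) β t e‖ ≤ r}).indicator (tiltWE ρ H g β) := by
  funext t
  by_cases ht : t ∈ goodTE ρ H β ε ∩ {t | ∀ e, ‖unscaleTE H (dimE ρ) β t e‖ ≤ r}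
  · rw [Set.indicator_of_mem ht, Set.indicator_of_mem ht, tiltWE, tiltWE]
    congr 1
    exact Finset.sum_congr rfl fun e _ => by rw [if_pos (ht.2 e)]
  · rw [Set.indicator_of_notMem ht, Set.indicator_of_notMem ht]

variable [TopologicalSpace G] [IsTopologicalGroup G] [CompactSpace G] [MeasurableSpace G] [BorelSpace G] [SecondCountableTopology G]

/-- **THE REPRESENTATION, density positive on the chart ball only** (the form consumed with the Helgason Jacobian `J` of `…ChartDensityJ`,
`hdens` verbatim from `exists_chartMeasureE_restrict_closedBall_eq_withDensity` with `c = ENNReal.ofReal cH`, `g = J`): as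
`integral_cond_boxState_eq_integral_tilted_G`, with `hgpos : ∀ a, ‖a‖ ≤ r → 0 < g a` in place of global positivity. -/
theorem integral_cond_boxState_eq_integral_tilted_G' (hρc : Continuous ρ) (hinj : Function.Injective ρ)
    (hρu : ∀ g, ρ g ∈ Matrix.unitaryGroup (Fin N) ℂ) {β ε r : ℝ} (hβ : 0 < β) (hH : 1 ≤ H) (hr : r ≤ 1 / 4)
    (hball : ∀ u : G, ‖ρ u - 1‖ ≤ (12 * (H : ℝ) ^ 2 + 2 * H + 1) * (Real.sqrt 2 * Real.sqrt (β ^ (2 * ε - 1))) →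
      u ∈ expChart ρ '' closedBall (0 : EuclideanSpace ℝ (Fin (dimE ρ))) r)
    {g : EuclideanSpace ℝ (Fin (dimE ρ)) → ℝ} (hgm : Measurable g) (hgpos : ∀ a, ‖a‖ ≤ r → 0 < g a) {c : ℝ≥0∞} (hc0 : c ≠ 0)
    (hctop : c ≠ ∞)
    (hdens : (chartMeasureE ρ (1 / 4)).restrict (closedBall 0 r) =
      (c • (volume : Measure (EuclideanSpace ℝ (Fin (dimE ρ)))).restrict (closedBall 0 r)).withDensity
        (fun a => ENNReal.ofReal (g a)))
    (hG0 : boxState ρ β H (coldGoodSetG ρ H β ε) ≠ 0)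
    (hγ : gaussD H (dimE ρ) (goodTE ρ H β ε ∩ {t | ∀ e, ‖unscaleTE H (dimE ρ) β t e‖ ≤ r}) ≠ 0)
    {X : LGConfig 4 G → ℝ} (hXm : Measurable X) (hXinv : IsZdGaugeInvariant X) (hX0 : ∀ U, 0 ≤ X U) :
    ∫ U, X U ∂((boxState ρ β H)[|coldGoodSetG ρ H β ε]) =
      ∫ t, X (cfgTE ρ H β t) ∂(((gaussD H (dimE ρ))[|goodTE ρ H β ε ∩ {t | ∀ e, ‖unscaleTE H (dimE ρ) β t e‖ ≤ r}]).tilted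
        ((goodTE ρ H β ε ∩ {t | ∀ e, ‖unscaleTE H (dimE ρ) β t e‖ ≤ r}).indicator (tiltWE ρ H g β))) := by
  set g' : EuclideanSpace ℝ (Fin (dimE ρ)) → ℝ := fun a => if ‖a‖ ≤ r then g a else 1 with hg'
  have hg'm : Measurable g' := measurable_ballClamp hgm r
  have hg'pos : ∀ a, 0 < g' a := fun a => by
    by_cases ha : ‖a‖ ≤ r
    · rw [hg']; dsimp only; rw [if_pos ha]; exact hgpos a ha
    · rw [hg']; dsimp only; rw [if_neg ha]; exact one_pos
  have hdens' : (chartMeasureE ρ (1 / 4)).restrict (closedBall 0 r) =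
      (c • (volume : Measure (EuclideanSpace ℝ (Fin (dimE ρ)))).restrict (closedBall 0 r)).withDensity
        (fun a => ENNReal.ofReal (g' a)) := by
    rw [hdens]
    refine withDensity_congr_ae (Measure.ae_smul_measure ?_ c)
    filter_upwards [ae_restrict_mem (isClosed_closedBall.measurableSet :
      MeasurableSet (closedBall (0 : EuclideanSpace ℝ (Fin (dimE ρ))) r))] with a ha
    rw [hg']; dsimp only; rw [if_pos (mem_closedBall_zero_iff.1 ha)]
  rw [← indicator_tiltWE_ballClamp ρ g β ε r]
  exact integral_cond_boxState_eq_integral_tilted_G ρ hρc hinj hρu hβ hH hr hball hg'm hg'pos hc0 hctop hdens' hG0 hγ hXm hXinv hX0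

end Summit.QuantumFields.YangMills.Theorems.ColdBoxAllGroups

end
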